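import Summits.CriticalPhenomena.PercolationContinuityZ3.Theorems.FK.PositiveFieldPlusFreeAgreement
import Literature.Probability.LatticeModels.MeanFieldLowerBound
import HarnessLib

/-!
# EVERY CORRELATION `h ↦ ⟨σ_A⟩_{β,h}` IS CONTINUOUS ON `(0,∞)`: NO TRANSITION IN A POSITIVE FIELD AT THE LEVEL OF ALL LOCAL
# SPIN PRODUCTS (Friedli–Velenik 2017, Lemma 3.31, Exercise 3.16, Thm. 3.25 (1))

Claimed R42 (8)(c) in the cell INBOX at 2026-08-29T01:45:00Z by fkp-10a gen 357 (NEW CLAIM #3 of the gen), addressed to coordinator fk-4 gen 288 (seated 01:00Z 2026-08-29 by l.8634; R160 / R161 in force); lineage row FO-10a-g357z (self-suggested), package g357-limit, label ZF-A.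
Helper file of the `fk-continuity` build cell (bschramm lane; `--supports stmt-CriticalPhenomena-4575`); builds on
p205010 (kernel theorem, internal audit signed; external expert review pending). No definitions, no named facts, no
sorries; standard axioms. UNCONDITIONAL (nearest-neighbour Ising model on `ℤ^d`, `d ≥ 1`, `β ≥ 0`, `h > 0`).

The plus state is right-continuous in the field (`plusCorr_continuousWithinAt_Ici_field`, Friedli–Velenik Lemma 3.31 (1):
a nonincreasing limit of continuous nondecreasing functions); the free state is LEFT-continuous in the field for the dual
reason (a nondecreasing limit over boxes — GKS II — of continuous nondecreasing functions is lower semicontinuous, hence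
left-continuous for a nondecreasing function); and at `h > 0` the two states agree on all spin products
(`freeCorr_eq_plusCorr_of_pos_field`, `PositiveFieldPlusFreeAgreement`). Hence:

* **`freeCorr_continuousWithinAt_Iic_field`** — for `β ≥ 0`, every finite `A` and every `h₀ > 0`, `h ↦ ⟨σ_A⟩^∅_{β,h}` is
  continuous from the left at `h₀` (the field twin of the tree's `freeCorr_continuousWithinAt_Iic`, which is the
  `β`-version);
* **`continuousAt_plusCorr_field_of_pos`**, **`continuousAt_freeCorr_field_of_pos`** — for `d ≥ 1`, `β ≥ 0`, `h > 0` and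
  every finite `A`: `t ↦ ⟨σ_A⟩⁺_{β,t}` and `t ↦ ⟨σ_A⟩^∅_{β,t}` are CONTINUOUS at `h`;
  `continuousOn_plusCorr_field_Ioi` — continuous on `(0,∞)`;
* `continuousAt_plusTruncated_field_of_pos` — the truncated pair function `u(x,y;·) = ⟨σ_{{x}∆{y}}⟩⁺ − ⟨σ_x⟩⁺⟨σ_y⟩⁺` is
  continuous on `(0,∞)` (it was known right-continuous, `plusTruncated_continuousWithinAt_Ici_field`);
* `continuousAt_magnetizationInField_of_pos'` — `m(β,·)` is continuous at every `h > 0` (also a consequence of GHS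
  concavity, `continuousOn_magnetizationInField_Ioi`; here from the two one-sided continuities).

## References

* S. Friedli, Y. Velenik, *Statistical Mechanics of Lattice Systems*, CUP (2017), Lemma 3.31, Exercise 3.16, Exercise 3.17,
  Thm. 3.25 (1), Remark 3.41. [FriedliVelenik2017]
-/

noncomputable section

namespace Summit.CriticalPhenomena.PercolationContinuityZ3.Theorems.FK

namespace IsingSusceptibility

open MeasureTheory Filter Topology Finset Set
open scoped symmDiff
open Literature.Probability.LatticeModels

variable {d : ℕ}

/-! ### Left-continuity of the free state in the field -/

/-- **Left-continuity of `h ↦ ⟨σ_A⟩^∅_{β,h}` at every `h₀ > 0`** (`β ≥ 0`): the free state is the nondecreasing limit over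
boxes of the finite-volume free correlations (GKS II), which are continuous and nondecreasing in `h ≥ 0`; given `ε > 0`, a
box `Λ(L)` with `⟨σ_A⟩^∅_{Λ(L);β,h₀} > ⟨σ_A⟩^∅_{β,h₀} − ε/2` and the continuity of `⟨σ_A⟩^∅_{Λ(L);β,·}` at `h₀` give
`⟨σ_A⟩^∅_{β,h₀} − ε < ⟨σ_A⟩^∅_{Λ(L);β,h} ≤ ⟨σ_A⟩^∅_{β,h} ≤ ⟨σ_A⟩^∅_{β,h₀}` for `0 ≤ h ≤ h₀` close to `h₀`.
[cite: FriedliVelenik2017, Exercise 3.16 and Lemma 3.31] -/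
theorem freeCorr_continuousWithinAt_Iic_field {β : ℝ} (hβ : 0 ≤ β) (A : Finset (Site d)) {h₀ : ℝ} (hh₀ : 0 < h₀) :
    ContinuousWithinAt (fun h => freeCorr d β h A) (Iic h₀) h₀ := by
  obtain ⟨L₀, hL₀⟩ := exists_forall_subset_box d A
  rw [Metric.continuousWithinAt_iff]
  intro ε hε
  -- a box whose free correlation at `h₀` is within `ε/2` of the limit
  have hconv := hasBoxLimit_isingCorr_free_holds (d := d) hβ hh₀.le A
  have hev : ∀ᶠ L : ℕ in atTop, L₀ ≤ L ∧
      freeCorr d β h₀ A - ε / 2 < isingCorr (zdGraph d) (box d L) β h₀ .free A :=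
    (eventually_ge_atTop L₀).and (hconv.eventually (lt_mem_nhds (by linarith)))
  obtain ⟨L, hLL₀, hL⟩ := hev.exists
  -- continuity of the finite-volume correlation in the field at `h₀`
  have hcont := (continuous_isingExpect_field (zdGraph d) (box d L) β .free (measurable_spinProduct A)).continuousAt
    (x := h₀)
  rw [Metric.continuousAt_iff] at hcont
  obtain ⟨δ, hδ, hδ'⟩ := hcont (ε / 2) (by linarith)
  refine ⟨min δ h₀, lt_min hδ hh₀, fun h hh hdist => ?_⟩
  have hhh₀ : h ≤ h₀ := hh
  have hdist' := hdist
  rw [Real.dist_eq, abs_lt] at hdist'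
  have hh0 : 0 ≤ h := by linarith [hdist'.1, min_le_right δ h₀]
  have h1 : freeCorr d β h A ≤ freeCorr d β h₀ A := freeCorr_mono_params hβ le_rfl hh0 hhh₀ A
  have h2 : isingCorr (zdGraph d) (box d L) β h .free A ≤ freeCorr d β h A :=
    isingCorr_free_box_le_freeCorr hβ hh0 (hL₀ L hLL₀)
  have h3 : dist (isingCorr (zdGraph d) (box d L) β h .free A)
      (isingCorr (zdGraph d) (box d L) β h₀ .free A) < ε / 2 :=
    hδ' (lt_of_lt_of_le hdist (min_le_left _ _))
  change dist (isingExpect (zdGraph d) (box d L) β h .free (spinProduct A))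
    (isingExpect (zdGraph d) (box d L) β h₀ .free (spinProduct A)) < ε / 2 at h3
  rw [Real.dist_eq, abs_lt] at h3
  rw [Real.dist_eq, abs_lt]
  change isingExpect (zdGraph d) (box d L) β h .free (spinProduct A) ≤ freeCorr d β h A at h2
  change freeCorr d β h₀ A - ε / 2 < isingExpect (zdGraph d) (box d L) β h₀ .free (spinProduct A) at hL
  constructor <;> linarith

/-! ### Continuity of all correlations in a positive field -/

/-- **For `d ≥ 1`, `β ≥ 0`, `h > 0` and every finite `A`, `t ↦ ⟨σ_A⟩⁺_{β,t}` is continuous at `h`**: right-continuous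
(Lemma 3.31), and equal on `(0,∞)` to the left-continuous free correlation.
[cite: FriedliVelenik2017, Lemma 3.31, Exercise 3.16 and Thm. 3.25 (1)] -/
theorem continuousAt_plusCorr_field_of_pos (hd : 1 ≤ d) {β : ℝ} (hβ : 0 ≤ β) {h : ℝ} (hh : 0 < h)
    (A : Finset (Site d)) : ContinuousAt (fun t => plusCorr d β t A) h := by
  refine continuousAt_iff_continuous_left_right.2 ⟨?_, plusCorr_continuousWithinAt_Ici_field hβ A hh.le⟩
  refine (freeCorr_continuousWithinAt_Iic_field (d := d) hβ A hh).congr_of_eventuallyEq ?_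
    (freeCorr_eq_plusCorr_of_pos_field hd hβ hh A).symm
  filter_upwards [Ioc_mem_nhdsLE hh] with t ht
  exact (freeCorr_eq_plusCorr_of_pos_field hd hβ ht.1 A).symm

/-- **For `d ≥ 1`, `β ≥ 0`, `h > 0` and every finite `A`, `t ↦ ⟨σ_A⟩^∅_{β,t}` is continuous at `h`.**
[cite: FriedliVelenik2017, Lemma 3.31, Exercise 3.16 and Thm. 3.25 (1)] -/
theorem continuousAt_freeCorr_field_of_pos (hd : 1 ≤ d) {β : ℝ} (hβ : 0 ≤ β) {h : ℝ} (hh : 0 < h)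
    (A : Finset (Site d)) : ContinuousAt (fun t => freeCorr d β t A) h := by
  refine (continuousAt_plusCorr_field_of_pos hd hβ hh A).congr_of_eventuallyEq ?_
  filter_upwards [Ioi_mem_nhds hh] with t ht
  exact freeCorr_eq_plusCorr_of_pos_field hd hβ ht A

/-- `t ↦ ⟨σ_A⟩⁺_{β,t}` is continuous on `(0,∞)` (`d ≥ 1`, `β ≥ 0`, every finite `A`). [cite: FriedliVelenik2017, Lemma 3.31 and Thm. 3.25 (1)] -/
theorem continuousOn_plusCorr_field_Ioi (hd : 1 ≤ d) {β : ℝ} (hβ : 0 ≤ β) (A : Finset (Site d)) :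
    ContinuousOn (fun t => plusCorr d β t A) (Ioi 0) := fun _ ht =>
  (continuousAt_plusCorr_field_of_pos hd hβ ht A).continuousWithinAt

/-- **The plus truncated pair function is continuous in the field on `(0,∞)`**: for `d ≥ 1`, `β ≥ 0`, `h > 0`,
`t ↦ ⟨σ_{{x}∆{y}}⟩⁺_{β,t} − ⟨σ_x⟩⁺_{β,t}⟨σ_y⟩⁺_{β,t}` is continuous at `h` (it was known right-continuous,
`plusTruncated_continuousWithinAt_Ici_field`). [cite: FriedliVelenik2017, Lemma 3.31 and Thm. 3.25 (1)] -/
theorem continuousAt_plusTruncated_field_of_pos (hd : 1 ≤ d) {β : ℝ} (hβ : 0 ≤ β) {h : ℝ} (hh : 0 < h)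
    (x y : Site d) :
    ContinuousAt (fun t => plusCorr d β t ({x} ∆ {y}) - plusCorr d β t {x} * plusCorr d β t {y}) h :=
  (continuousAt_plusCorr_field_of_pos hd hβ hh _).sub
    ((continuousAt_plusCorr_field_of_pos hd hβ hh _).mul (continuousAt_plusCorr_field_of_pos hd hβ hh _))

/-- **`m(β,·)` is continuous at every `h > 0`** (`d ≥ 1`, `β ≥ 0`), from the two one-sided continuities (the tree's
`continuousOn_magnetizationInField_Ioi` derives the same from GHS concavity). [cite: FriedliVelenik2017, Lemma 3.31 and Remark 3.41] -/
theorem continuousAt_magnetizationInField_of_pos' (hd : 1 ≤ d) {β : ℝ} (hβ : 0 ≤ β) {h : ℝ} (hh : 0 < h) :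
    ContinuousAt (fun t => magnetizationInField d β t) h := by
  have hm : ∀ t, magnetizationInField d β t = plusCorr d β t {0} := fun t => by
    simp only [magnetizationInField, plusCorr, spinProduct_singleton]
  simp only [hm]
  exact continuousAt_plusCorr_field_of_pos hd hβ hh {0}

end IsingSusceptibility

end Summit.CriticalPhenomena.PercolationContinuityZ3.Theorems.FK

end
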